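import Summits.QuantumAdvantage.QuantumAdvantage.Theorems.LinnikCubicClassGroupsDegreeOnePrimesEscapeConjClassPNTAll
import HarnessLib

/-!
# Preliminaries for the Chebotarev prime number theorem over an arbitrary base: junk and exceptional main term

Topic `Summits/QuantumAdvantage/QuantumAdvantage/Theorems`, cell B2b-1 (linnik-cubic), PART A (gen 16); helper
toward the crux `DegreeOnePrimesEscape` (stmt-QuantumAdvantage-11543) — two lemmas of the gen-13 assembly
(`classJunk_le`, `exceptional_mainTerm_ge`) restated for an ABSTRACT Galois pair `E ⊆ N` / an arbitrary number
field `N` (the originals take `E : IntermediateField ℚ N`, resp. an idle `IsGalois ℚ N`), as needed by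
`frobeniusClass_PNT_relative` (`…ConjClassPNTRelative.lean`).  HONEST FRAMING: the value of this file is a
THEOREM (kernel-checked bookkeeping) — NOT summit progress.

* `classJunk_le'` — `m((ψ_E − θ_E)(x) + [E:ℚ](√x + 1) log x + [E:ℚ] ω(d_N) log|d_N|) ≤ 40 [N:ℚ] x^{3/4}` once
  `|d_N| ≤ x^{1/8}` (`m = [N:E]`);
* `exceptional_mainTerm_ge'` — `ζ_N(β₁) = 0`, `3/4 ≤ β₁ < 1`, `log x ≥ 16` ⟹
  `x − x^{β₁}/β₁ ≥ c₁(n) x / (4 |d_N|^{2(1+n²)})` (Stark's effective bound `1 − β₁ ≥ c₁ Q^{−2}`).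
-/

noncomputable section

open scoped NumberField nonZeroDivisors Classical
open Finset Real Ideal NumberField IsDedekindDomain
open Literature.NumberTheory.NumberFields Literature.NumberTheory.LFunctions
  Literature.NumberTheory.LFunctions.NumberField Literature.NumberTheory.GaloisRepresentations

namespace Summit.QuantumAdvantage.QuantumAdvantage.Theorems.DegreeOnePrimesEscape

/-- **The junk of Deuring's reduction is `≤ 40 n x^{3/4}`** once `|d_N| ≤ x^{1/8}` (`classJunk_le` for an
abstract Galois pair `E ⊆ N`):
`m((ψ_E − θ_E)(x) + [E:ℚ](√x + 1) log x + [E:ℚ] ω(d_N) log|d_N|) ≤ 40 [N:ℚ] x^{3/4}` (`m [E:ℚ] = [N:ℚ]`). -/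
theorem classJunk_le' {E N : Type} [Field E] [NumberField E] [Field N] [NumberField N] [Algebra E N]
    [IsGalois E N] {x : ℝ} (hx : 1 < x)
    (hdx : ((NumberField.discr N).natAbs : ℝ) ≤ x ^ (1 / 8 : ℝ)) :
    (Nat.card (N ≃ₐ[E] N) : ℝ) * ((chebyshevPsiIdeal E x - chebyshevThetaIdeal E x) +
        Module.finrank ℚ E * (Real.sqrt x + 1) * Real.log x +
        Module.finrank ℚ E * ((NumberField.discr N).natAbs.primeFactors.card) *
          Real.log ((NumberField.discr N).natAbs : ℝ)) ≤
      40 * Module.finrank ℚ N * x ^ (3 / 4 : ℝ) := by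
  haveI : FiniteDimensional E N := Module.Finite.of_restrictScalars_finite ℚ E N
  have hx0 : 0 < x := by linarith
  have hx1 : 1 ≤ x := hx.le
  set m : ℕ := Module.finrank E N with hm
  have hcard : Nat.card (N ≃ₐ[E] N) = m := IsGalois.card_aut_eq_finrank E N
  set nE : ℝ := (Module.finrank ℚ E : ℝ) with hnE
  set nN : ℝ := (Module.finrank ℚ N : ℝ) with hnN
  have hdeg : (m : ℝ) * nE = nN := by
    rw [hnE, hnN, ← Module.finrank_mul_finrank ℚ E N, hm]; push_cast; ring
  have hm0 : (0 : ℝ) ≤ m := Nat.cast_nonneg _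
  have hnE0 : 0 ≤ nE := Nat.cast_nonneg _
  have hnN0 : 0 ≤ nN := Nat.cast_nonneg _
  rw [hcard]
  -- elementary functions of `x`
  have hlog0 : 0 < Real.log x := Real.log_pos hx
  have hlog8 : Real.log x ≤ 8 * x ^ (1 / 8 : ℝ) := by
    have := Real.log_le_rpow_div hx0.le (by norm_num : (0 : ℝ) < 1 / 8)
    linarith
  have hsqrt : Real.sqrt x = x ^ (1 / 2 : ℝ) := Real.sqrt_eq_rpow x
  have hsqrt1 : 1 ≤ Real.sqrt x := by rw [← Real.sqrt_one]; exact Real.sqrt_le_sqrt hx1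
  have h18 : 0 ≤ x ^ (1 / 8 : ℝ) := Real.rpow_nonneg hx0.le _
  have h58 : x ^ (1 / 2 : ℝ) * x ^ (1 / 8 : ℝ) ≤ x ^ (3 / 4 : ℝ) := by
    rw [← Real.rpow_add hx0]; exact Real.rpow_le_rpow_of_exponent_le hx1 (by norm_num)
  have h14 : x ^ (1 / 8 : ℝ) * x ^ (1 / 8 : ℝ) ≤ x ^ (3 / 4 : ℝ) := by
    rw [← Real.rpow_add hx0]; exact Real.rpow_le_rpow_of_exponent_le hx1 (by norm_num)
  have h34 : 0 ≤ x ^ (3 / 4 : ℝ) := Real.rpow_nonneg hx0.le _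
  -- `√x log x ≤ 8 x^{3/4}`
  have hsl : Real.sqrt x * Real.log x ≤ 8 * x ^ (3 / 4 : ℝ) := by
    rw [hsqrt]
    calc x ^ (1 / 2 : ℝ) * Real.log x ≤ x ^ (1 / 2 : ℝ) * (8 * x ^ (1 / 8 : ℝ)) :=
          mul_le_mul_of_nonneg_left hlog8 (Real.rpow_nonneg hx0.le _)
      _ = 8 * (x ^ (1 / 2 : ℝ) * x ^ (1 / 8 : ℝ)) := by ring
      _ ≤ 8 * x ^ (3 / 4 : ℝ) := by nlinarith
  -- (1) the prime powers
  have h1 : chebyshevPsiIdeal E x - chebyshevThetaIdeal E x ≤ nE * (2 * Real.sqrt x * Real.log x) := by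
    refine (chebyshevPsiIdeal_sub_chebyshevThetaIdeal_le E hx1).trans ?_
    have h := primeIdealCount_le_two_mul_finrank_mul E (Real.sqrt_nonneg x)
    calc (primeIdealCount E (Real.sqrt x) : ℝ) * Real.log x ≤ (2 * nE * Real.sqrt x) * Real.log x :=
          mul_le_mul_of_nonneg_right h hlog0.le
      _ = nE * (2 * Real.sqrt x * Real.log x) := by ring
  -- (2) the primes of degree `≥ 2`
  have h2 : (Real.sqrt x + 1) * Real.log x ≤ 2 * Real.sqrt x * Real.log x := by nlinarith
  -- (3) the primes above `d_N`: `ω(d) log d ≤ d log d ≤ x^{1/8} x^{1/8}`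
  set d : ℝ := ((NumberField.discr N).natAbs : ℝ) with hd
  have hd1 : 1 ≤ d := by
    rw [hd]; exact_mod_cast Nat.pos_of_ne_zero (Int.natAbs_ne_zero.mpr (NumberField.discr_ne_zero N))
  have hω : (((NumberField.discr N).natAbs.primeFactors.card : ℕ) : ℝ) ≤ d := by
    have h1 : (NumberField.discr N).natAbs.primeFactors.card ≤ (NumberField.discr N).natAbs := by
      calc (NumberField.discr N).natAbs.primeFactors.card ≤ (Finset.Icc 1 (NumberField.discr N).natAbs).card :=
            Finset.card_le_card fun p hp ↦ Finset.mem_Icc.mpr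
              ⟨(Nat.prime_of_mem_primeFactors hp).one_lt.le, Nat.le_of_mem_primeFactors hp⟩
        _ = (NumberField.discr N).natAbs := by simp
    rw [hd]; exact_mod_cast h1
  have hlogd : Real.log d ≤ x ^ (1 / 8 : ℝ) := by
    have h1 : Real.log d ≤ Real.log (x ^ (1 / 8 : ℝ)) := Real.log_le_log (by linarith) hdx
    rw [Real.log_rpow hx0] at h1
    nlinarith
  have hlogd0 : 0 ≤ Real.log d := Real.log_nonneg hd1
  have h3 : (((NumberField.discr N).natAbs.primeFactors.card : ℕ) : ℝ) * Real.log d ≤ x ^ (3 / 4 : ℝ) := by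
    calc (((NumberField.discr N).natAbs.primeFactors.card : ℕ) : ℝ) * Real.log d ≤ d * Real.log d :=
          mul_le_mul_of_nonneg_right hω hlogd0
      _ ≤ x ^ (1 / 8 : ℝ) * x ^ (1 / 8 : ℝ) := mul_le_mul hdx hlogd hlogd0 h18
      _ ≤ x ^ (3 / 4 : ℝ) := h14
  -- assemble
  have hsum : (chebyshevPsiIdeal E x - chebyshevThetaIdeal E x) + nE * (Real.sqrt x + 1) * Real.log x +
      nE * ((NumberField.discr N).natAbs.primeFactors.card) * Real.log d ≤ nE * (33 * x ^ (3 / 4 : ℝ)) := by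
    have e1 : nE * (2 * Real.sqrt x * Real.log x) ≤ nE * (16 * x ^ (3 / 4 : ℝ)) :=
      mul_le_mul_of_nonneg_left (by nlinarith) hnE0
    have e2 : nE * (Real.sqrt x + 1) * Real.log x ≤ nE * (16 * x ^ (3 / 4 : ℝ)) := by
      rw [mul_assoc]; exact mul_le_mul_of_nonneg_left (h2.trans (by nlinarith)) hnE0
    have e3 : nE * ((NumberField.discr N).natAbs.primeFactors.card) * Real.log d ≤ nE * x ^ (3 / 4 : ℝ) := by
      rw [mul_assoc]; exact mul_le_mul_of_nonneg_left h3 hnE0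
    linarith
  calc (m : ℝ) * ((chebyshevPsiIdeal E x - chebyshevThetaIdeal E x) + nE * (Real.sqrt x + 1) * Real.log x +
        nE * ((NumberField.discr N).natAbs.primeFactors.card) * Real.log d)
      ≤ m * (nE * (33 * x ^ (3 / 4 : ℝ))) := mul_le_mul_of_nonneg_left hsum hm0
    _ = 33 * nN * x ^ (3 / 4 : ℝ) := by rw [← hdeg]; ring
    _ ≤ 40 * nN * x ^ (3 / 4 : ℝ) := by nlinarith [mul_nonneg hnN0 h34]

/-- `exceptional_mainTerm_ge` (`…DivisionMainTerm.lean`) for EVERY number field `N` (its hypothesis `IsGalois ℚ N`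
is idle): if `ζ_N(β₁) = 0` with `3/4 ≤ β₁ < 1`, then `x − x^{β₁}/β₁ ≥ c₁ x /(4 d^{2(1+n²)})` for `log x ≥ 16`. -/
theorem exceptional_mainTerm_ge' (n : ℕ) (hn : 1 < n) :
    ∃ c₁ : ℝ, 0 < c₁ ∧ c₁ ≤ 1 ∧ ∀ (N : Type) [Field N] [NumberField N],
      Module.finrank ℚ N = n → ∀ β₁ : ℝ, dedekindZeta₁ N β₁ = 0 → 3 / 4 ≤ β₁ → β₁ < 1 →
        ∀ x : ℝ, 1 < x → 16 ≤ Real.log x →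
          x * c₁ / (4 * ((NumberField.discr N).natAbs : ℝ) ^ (2 * ((1 : ℝ) + n * n))) ≤
            x - x ^ β₁ / β₁ := by
  obtain ⟨c₁, hc₁, hc₁1, heff⟩ := Residue.one_sub_realZero_ge_condQn_rpow n hn
  refine ⟨c₁, hc₁, hc₁1, fun N _ _ hN β₁ hζ₁ hβ34 hβ₁1 x hx1 hx16 => ?_⟩
  have hN1 : 1 < Module.finrank ℚ N := by rw [hN]; exact hn
  set d : ℝ := ((NumberField.discr N).natAbs : ℝ) with hd
  set e : ℝ := (1 : ℝ) + n * n with he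
  have hd3 : (3 : ℝ) ≤ d := three_le_natAbs_discr_real N hN1
  have hd0 : (0 : ℝ) < d := by linarith
  have hx0 : 0 < x := by linarith
  have hβne : (β₁ : ℂ) ≠ 1 := fun h => hβ₁1.ne (by exact_mod_cast h)
  -- `Q_N ≤ d^e`
  have hQN : ThornerZaman.condQn N ≤ d ^ e := by
    have h1 : ThornerZaman.condQn N = d * (n : ℝ) ^ n := by
      rw [hd, ThornerZaman.condQn, hN, ← Int.cast_abs, Int.abs_eq_natAbs, Int.cast_natCast]
    have h2 : d ^ e = d * d ^ (n * n) := by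
      rw [he, show (1 : ℝ) + n * n = (((1 + n * n : ℕ)) : ℝ) by push_cast; ring, Real.rpow_natCast,
        pow_add, pow_one]
    rw [h1, h2]
    exact mul_le_mul_of_nonneg_left (pow_self_le_rpow_sq le_rfl hd3) hd0.le
  have hQ12 : (12 : ℝ) ≤ ThornerZaman.condQn N := ThornerZaman.twelve_le_condQn (K := N) hN1
  -- Stark: `c₁ Q_N^{−2} ≤ 1 − β₁`
  have hLz : classGroupLFunction N 1 β₁ = 0 := by
    rw [classGroupLFunction_one N hβne]; exact (dedekindZeta₁_eq_zero_iff hβne).mp hζ₁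
  have hδ : c₁ * ThornerZaman.condQn N ^ (-(2 : ℝ)) ≤ 1 - β₁ :=
    heff N hN 1 (mul_one (1 : ClassGroup (𝓞 N) →* ℂˣ)) β₁ hβ₁1 hLz
  have hQm2 : ThornerZaman.condQn N ^ (-(2 : ℝ)) ≤ 1 :=
    Real.rpow_le_one_of_one_le_of_nonpos (by linarith) (by norm_num)
  have hQm2' : 0 ≤ ThornerZaman.condQn N ^ (-(2 : ℝ)) := Real.rpow_nonneg (by linarith) _
  have hMge : x / 4 * min 1 ((1 - β₁) * Real.log x) ≤ x - x ^ β₁ / β₁ := by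
    have := sub_mul_rpow_div_ge (r := 1) hx1 hx16 hβ34 hβ₁1 (by norm_num)
    rwa [one_mul] at this
  have hMlow : x / 4 * (c₁ * ThornerZaman.condQn N ^ (-(2 : ℝ))) ≤ x - x ^ β₁ / β₁ :=
    mainTerm_ge_of_stark hx0.le hMge hδ hc₁1 hc₁.le hQm2 hQm2' (by linarith)
  have hQinv : (d ^ (2 * e))⁻¹ ≤ ThornerZaman.condQn N ^ (-(2 : ℝ)) := by
    rw [Real.rpow_neg (by linarith), show (2 : ℝ) * e = e * 2 by ring, Real.rpow_mul hd0.le]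
    exact inv_anti₀ (by positivity) (Real.rpow_le_rpow (by linarith) hQN (by norm_num))
  have hde0 : 0 < d ^ (2 * e) := by positivity
  calc x * c₁ / (4 * d ^ (2 * e)) = x / 4 * (c₁ * (d ^ (2 * e))⁻¹) := by field_simp
    _ ≤ x / 4 * (c₁ * ThornerZaman.condQn N ^ (-(2 : ℝ))) :=
        mul_le_mul_of_nonneg_left (mul_le_mul_of_nonneg_left hQinv hc₁.le) (by positivity)
    _ ≤ x - x ^ β₁ / β₁ := hMlow


end Summit.QuantumAdvantage.QuantumAdvantage.Theorems.DegreeOnePrimesEscape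

end
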